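import Summits.AtomisticToContinuum.HydrodynamicLimit.Theorems.OneFlightGossipEngineCollisionActivityTailsNearFieldKineticTailsStatics
import Mathlib.MeasureTheory.Integral.Lebesgue.Add
import Mathlib.MeasureTheory.Measure.Typeclasses.Probability
import Mathlib.Analysis.Complex.Exponential
import Mathlib.Algebra.Ring.GeomSum
import Mathlib.Algebra.Order.Floor.Semiring
import HarnessLib

/-!
# `CollisionActivityTails` (stmt-AtomisticToContinuum-13734), line `plaque-thinning-count-ld`, stub 2g:
an exponential moment of a sum of tails from joint exponential tails
(`stub_lmgfOfJointTails : LMGFOfJointTails`)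

Helper file (`--supports stmt-AtomisticToContinuum-13734`) for the crux
`Summit.AtomisticToContinuum.HydrodynamicLimit.Theses.OneFlightGossipEngine.CollisionActivityTails`, line
`plaque-thinning-count-ld`, registered stub `stub_lmgfOfJointTails : LMGFOfJointTails` — the GENERIC measure-theoretic
assembly piece of the line (no spheres involved): on a probability space, for finitely many a.e.-measurable real
functionals `F_i`, a level `V`, a prefactor `p ≥ 0` and rates `0 < γ < r`, if for every index set `S` and every integer
grid of levels `V + m_i` the JOINT tail `μ {∀ i ∈ S, V + m_i < F_i}` is at most `∏_{i ∈ S} p e^{-r (V + m_i)}`, then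
`∫ exp (γ Σ_i 𝟙{V < F_i} F_i) dμ ≤ exp (n q)`, `q = p e^{γ} e^{-(r-γ) V} / (1 - e^{-(r-γ)})`.

The statement `LMGFOfJointTails` is copied VERBATIM from the skeleton
`Cruxes/CollisionActivityTails/Lines/plaque_thinning_count_ld.lean`; the lead bridges definitionally. The scalar tail
functional `tailFn V y = 𝟙{V < y} y` and its two evaluation lemmas `tailFn_of_lt`, `tailFn_of_le` are the line's
(`…CollisionActivityTailsNearFieldKineticMeasurable`, `…CollisionActivityTailsNearFieldKineticTailsStatics`).

## Proof

Integer layer cake plus subset expansion, entirely in `ℝ≥0∞`.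
* Pointwise (`ofReal_exp_tailFn_le`): for every truncation `M ≥ F z - V`,
  `e^{γ 𝟙{V<F}F} ≤ 1 + Σ_{m ≤ M} e^{γ(V+m+1)} 𝟙{V + m < F}` (if `F ≤ V` the left side is `1`; if
  `F ∈ (V + m₀, V + m₀ + 1]` the single term `m = m₀` dominates). Hence
  `e^{γ Σ_i tailFn V F_i} = ∏_i e^{γ tailFn V F_i} ≤ ⨆_M ∏_i (1 + X_i^M)` with the truncated layer cakes `X_i^M`
  (`layer`), a monotone sequence of measurable majorants (`prodMaj`), and monotone convergence applies.
* For fixed `M` (`lintegral_prodMaj_le`): `∏_i (1 + X_i^M) = Σ_x ∏_i term_i(x_i)` over `x : Fin n → Option (Fin (M+1))`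
  (`Fintype.prod_sum`; `x_i = none` is the factor `1`, `x_i = some k` the `k`-th layer). Each product is the constant
  `∏ e^{γ(V+k_i+1)}` on the joint event `{∀ i with x_i = some k_i, V + k_i < F_i}` and `0` off it, so its integral is
  bounded by the hypothesis, and the bound FACTORISES again: `Σ_x ∏_i b(x_i) = (1 + Σ_{k ≤ M} b_k)^n` with
  `b_k = e^{γ(V+k+1)} p e^{-r(V+k)} = p e^{γ} e^{-(r-γ)V} e^{-(r-γ)k}`; the geometric sum is `≤ q`, and
  `(1 + q)^n ≤ e^{nq}`.
* A.e.-measurable `F_i` are replaced by measurable modifications (`AEMeasurable.mk`); both the integral and the joint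
  tails are insensitive to the null set where they differ.

References: folklore (layer-cake / exponential Chebyshev bookkeeping); e.g. R. Durrett, *Probability: Theory and
Examples* (4th ed., 2010), §1.6 and Lemma 2.2.8 for the layer-cake formula `E X = ∫ P(X > t) dt` that the integer grid
discretises.
-/

noncomputable section

open MeasureTheory Set Filter Topology
open scoped ENNReal

namespace Summit.AtomisticToContinuum.HydrodynamicLimit.Theorems.CollisionActivityTailsLMGFOfJointTails

open Summit.AtomisticToContinuum.HydrodynamicLimit.Theorems.CollisionActivityTailsNearFieldKineticTails
  (tailFn tailFn_of_lt tailFn_of_le)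

/-! ## The statement (verbatim from the skeleton) -/

/-- **STUB 2g — GENERIC: an exponential moment of a sum of tails from JOINT exponential tails** (assembly piece,
closable; pure measure theory, no spheres). On a probability space, for finitely many a.e.-measurable real functionals
`F_i`, a level `V`, a prefactor `p ≥ 0` and rates `0 < γ < r`: if for every index set `S` and every integer grid of
levels `V + m_i` the JOINT tail is at most the product `∏_{i∈S} p e^{-r (V + m_i)}`, then
`∫ exp(γ Σ_i 𝟙{V < F_i} F_i) ≤ exp(n · q)`, `q = p e^{γ} e^{-(r-γ)V} / (1 - e^{-(r-γ)})`.
Proof: `e^{γ 𝟙{V<F}F} ≤ 1 + Σ_{m ≥ 0} e^{γ(V+m+1)} 𝟙{V + m < F}`, expand the product over `i` into a sum over subsets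
`S` and grids `m : S → ℕ`, integrate term by term, and resum: `Σ_S q^{|S|} = (1+q)^n ≤ e^{nq}`. -/
def LMGFOfJointTails : Prop :=
  ∀ (α : Type) [MeasurableSpace α] (μ : Measure α) [IsProbabilityMeasure μ] (n : ℕ) (F : Fin n → α → ℝ),
    (∀ i, AEMeasurable (F i) μ) →
    ∀ (V p r γ : ℝ), 0 ≤ p → 0 < γ → γ < r →
    (∀ (S : Finset (Fin n)) (m : Fin n → ℕ),
      μ {z | ∀ i ∈ S, V + (m i : ℝ) < F i z} ≤
        ENNReal.ofReal (∏ i ∈ S, p * Real.exp (-(r * (V + (m i : ℝ)))))) →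
    ∫⁻ z, ENNReal.ofReal (Real.exp (γ * ∑ i, tailFn V (F i z))) ∂μ ≤
      ENNReal.ofReal (Real.exp ((n : ℝ) *
        (p * Real.exp γ * Real.exp (-((r - γ) * V)) / (1 - Real.exp (-(r - γ))))))

/-! ## The truncated integer layer cake -/

variable {α : Type*}

/-- The weight of the `m`-th layer: `e^{γ (V + m + 1)}`. -/
def wt (γ V : ℝ) (m : ℕ) : ℝ := Real.exp (γ * (V + m + 1))

/-- The `m`-th level event of `F` above `V`: `{z | V + m < F z}`. -/
def ev (V : ℝ) (F : α → ℝ) (m : ℕ) : Set α := {z | V + (m : ℝ) < F z}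

/-- The truncated integer layer cake `X^M(z) = Σ_{m ≤ M} e^{γ(V+m+1)} 𝟙{V + m < F z}` (in `ℝ≥0∞`). -/
def layer (γ V : ℝ) (F : α → ℝ) (M : ℕ) (z : α) : ℝ≥0∞ :=
  ∑ m ∈ Finset.range (M + 1), (ev V F m).indicator (fun _ => ENNReal.ofReal (wt γ V m)) z

/-- The `M`-th product majorant `∏_i (1 + X_i^M(z))` of `e^{γ Σ_i tailFn V (F_i z)}`. -/
def prodMaj {n : ℕ} (γ V : ℝ) (F : Fin n → α → ℝ) (M : ℕ) (z : α) : ℝ≥0∞ :=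
  ∏ i, (1 + layer γ V (F i) M z)

/-- **Pointwise layer cake.** For `γ ≥ 0` and any truncation `M ≥ F z - V`:
`e^{γ tailFn V (F z)} ≤ 1 + Σ_{m ≤ M} e^{γ(V+m+1)} 𝟙{V + m < F z}`. -/
theorem ofReal_exp_tailFn_le {γ V : ℝ} (hγ : 0 ≤ γ) {F : α → ℝ} {z : α} {M : ℕ}
    (hM : F z - V ≤ M) :
    ENNReal.ofReal (Real.exp (γ * tailFn V (F z))) ≤ 1 + layer γ V F M z := by
  by_cases hVF : V < F z
  · rw [tailFn_of_lt hVF]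
    have hpos : 0 < F z - V := sub_pos.2 hVF
    have h1 : 1 ≤ ⌈F z - V⌉₊ := Nat.ceil_pos.2 hpos
    set m₀ : ℕ := ⌈F z - V⌉₊ - 1 with hm₀
    have hm₀succ : (m₀ : ℝ) + 1 = (⌈F z - V⌉₊ : ℝ) := by
      rw [hm₀, Nat.cast_sub h1, Nat.cast_one]
      ring
    have hle : F z ≤ V + m₀ + 1 := by
      have := Nat.le_ceil (F z - V)
      linarith
    have hlt : V + (m₀ : ℝ) < F z := by
      have := Nat.ceil_lt_add_one hpos.le
      linarith
    have hm₀M : m₀ ∈ Finset.range (M + 1) := by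
      rw [Finset.mem_range]
      have : (m₀ : ℝ) < M + 1 := by linarith
      exact_mod_cast this
    calc ENNReal.ofReal (Real.exp (γ * F z))
        ≤ ENNReal.ofReal (wt γ V m₀) :=
          ENNReal.ofReal_le_ofReal (Real.exp_le_exp.2 (mul_le_mul_of_nonneg_left hle hγ))
      _ = (ev V F m₀).indicator (fun _ => ENNReal.ofReal (wt γ V m₀)) z :=
          (Set.indicator_of_mem (show z ∈ ev V F m₀ from hlt) (fun _ => ENNReal.ofReal (wt γ V m₀))).symm
      _ ≤ layer γ V F M z :=
          Finset.single_le_sum (f := fun m => (ev V F m).indicator (fun _ => ENNReal.ofReal (wt γ V m)) z)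
            (fun _ _ => zero_le) hm₀M
      _ ≤ 1 + layer γ V F M z := le_add_self
  · rw [tailFn_of_le (not_lt.1 hVF), mul_zero, Real.exp_zero, ENNReal.ofReal_one]
    exact le_self_add

/-- **Pointwise majorant.** `e^{γ Σ_i tailFn V (F_i z)} ≤ ⨆_M ∏_i (1 + X_i^M(z))` for `γ ≥ 0`
(take `M ≥ max_i (F_i z - V)`). -/
theorem ofReal_exp_sum_tailFn_le_iSup_prodMaj {n : ℕ} {γ V : ℝ} (hγ : 0 ≤ γ) (F : Fin n → α → ℝ)
    (z : α) :
    ENNReal.ofReal (Real.exp (γ * ∑ i, tailFn V (F i z))) ≤ ⨆ M, prodMaj γ V F M z := by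
  set M : ℕ := ∑ i, ⌈F i z - V⌉₊ with hM
  have hMi : ∀ i, F i z - V ≤ M := fun i =>
    (Nat.le_ceil _).trans (by
      rw [hM]
      exact_mod_cast Finset.single_le_sum (f := fun j => ⌈F j z - V⌉₊) (fun _ _ => Nat.zero_le _)
        (Finset.mem_univ i))
  refine le_iSup_of_le M ?_
  rw [prodMaj, Finset.mul_sum, Real.exp_sum, ENNReal.ofReal_prod_of_nonneg fun i _ => (Real.exp_pos _).le]
  exact Finset.prod_le_prod' fun i _ => ofReal_exp_tailFn_le hγ (hMi i)

/-- The product majorants increase with the truncation `M`. -/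
theorem prodMaj_mono {n : ℕ} (γ V : ℝ) (F : Fin n → α → ℝ) : Monotone (prodMaj γ V F) := by
  intro M M' h z
  unfold prodMaj layer
  refine Finset.prod_le_prod' fun i _ => add_le_add_right ?_ 1
  exact Finset.sum_le_sum_of_subset (Finset.range_subset_range.2 (by omega))

/-! ## The expansion of the `M`-th majorant and its integral -/

/-- Expansion factor indexed by `j : Option (Fin (M+1))`: `1` for `none`, the `k`-th layer for `some k`. -/
def term (γ V : ℝ) (F : α → ℝ) {M : ℕ} (j : Option (Fin (M + 1))) (z : α) : ℝ≥0∞ :=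
  j.elim 1 fun k => (ev V F k).indicator (fun _ => ENNReal.ofReal (wt γ V k)) z

/-- Real weight of an expansion index: `1` for `none`, `e^{γ(V+k+1)}` for `some k`. -/
def wr (γ V : ℝ) {M : ℕ} (j : Option (Fin (M + 1))) : ℝ := j.elim 1 fun k => wt γ V k

/-- The integrated weight of the `k`-th layer: `b_k = e^{γ(V+k+1)} · p e^{-r(V+k)}`. -/
def bw (γ V p r : ℝ) (k : ℕ) : ℝ := wt γ V k * (p * Real.exp (-(r * (V + k))))

/-- Integrated weight of an expansion index: `1` for `none`, `b_k` for `some k`. -/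
def br (γ V p r : ℝ) {M : ℕ} (j : Option (Fin (M + 1))) : ℝ := j.elim 1 fun k => bw γ V p r k

/-- Level of an expansion index (`0` for `none`, `k` for `some k`). -/
def lev {M : ℕ} (j : Option (Fin (M + 1))) : ℕ := j.elim 0 fun k => (k : ℕ)

/-- `wr ≥ 0`. -/
theorem wr_nonneg (γ V : ℝ) {M : ℕ} (j : Option (Fin (M + 1))) : 0 ≤ wr γ V j := by
  rcases j with _ | k
  · exact zero_le_one
  · exact (Real.exp_pos _).le

/-- `bw ≥ 0` for `p ≥ 0`. -/
theorem bw_nonneg (γ V : ℝ) {p : ℝ} (hp : 0 ≤ p) (r : ℝ) (k : ℕ) : 0 ≤ bw γ V p r k :=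
  mul_nonneg (Real.exp_pos _).le (mul_nonneg hp (Real.exp_pos _).le)

/-- `br ≥ 0` for `p ≥ 0`. -/
theorem br_nonneg (γ V : ℝ) {p : ℝ} (hp : 0 ≤ p) (r : ℝ) {M : ℕ} (j : Option (Fin (M + 1))) :
    0 ≤ br γ V p r j := by
  rcases j with _ | k
  · exact zero_le_one
  · exact bw_nonneg γ V hp r k

/-- **Geometric resummation.** `Σ_{k ≤ M} b_k ≤ q = p e^{γ} e^{-(r-γ)V} / (1 - e^{-(r-γ)})` for `p ≥ 0`, `γ < r`. -/
theorem sum_bw_le {V p r γ : ℝ} (hp : 0 ≤ p) (hγr : γ < r) (M : ℕ) :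
    ∑ k ∈ Finset.range (M + 1), bw γ V p r k ≤
      p * Real.exp γ * Real.exp (-((r - γ) * V)) / (1 - Real.exp (-(r - γ))) := by
  set c₀ : ℝ := p * Real.exp γ * Real.exp (-((r - γ) * V)) with hc₀
  set ρ : ℝ := Real.exp (-(r - γ)) with hρ
  have hρ1 : ρ < 1 := Real.exp_lt_one_iff.2 (by linarith)
  have hρ0 : 0 ≤ ρ := (Real.exp_pos _).le
  have hc₀0 : 0 ≤ c₀ := by positivity
  have hterm : ∀ k : ℕ, bw γ V p r k = c₀ * ρ ^ k := by
    intro k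
    have h : Real.exp (γ * (V + k + 1)) * Real.exp (-(r * (V + k))) =
        Real.exp γ * Real.exp (-((r - γ) * V)) * Real.exp (k * (-(r - γ))) := by
      rw [← Real.exp_add, ← Real.exp_add, ← Real.exp_add]
      congr 1
      ring
    rw [hρ, ← Real.exp_nat_mul, hc₀, bw, wt]
    calc Real.exp (γ * (V + k + 1)) * (p * Real.exp (-(r * (V + k))))
        = p * (Real.exp (γ * (V + k + 1)) * Real.exp (-(r * (V + k)))) := by ring
      _ = _ := by rw [h]; ring
  simp_rw [hterm]
  rw [← Finset.mul_sum]
  have hgeom : ∑ k ∈ Finset.range (M + 1), ρ ^ k ≤ 1 / (1 - ρ) := by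
    rw [le_div_iff₀ (sub_pos.2 hρ1), geom_sum_mul_neg]
    linarith [pow_nonneg hρ0 (M + 1)]
  calc c₀ * ∑ k ∈ Finset.range (M + 1), ρ ^ k ≤ c₀ * (1 / (1 - ρ)) :=
        mul_le_mul_of_nonneg_left hgeom hc₀0
    _ = c₀ / (1 - ρ) := mul_one_div c₀ (1 - ρ)

variable [MeasurableSpace α]

/-- The product majorants are measurable when the `F_i` are. -/
theorem measurable_prodMaj {n : ℕ} (γ V : ℝ) {F : Fin n → α → ℝ} (hF : ∀ i, Measurable (F i)) (M : ℕ) :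
    Measurable (prodMaj γ V F M) := by
  unfold prodMaj layer
  refine Finset.measurable_prod _ fun i _ => Measurable.const_add ?_ 1
  exact Finset.measurable_sum _ fun m _ =>
    measurable_const.indicator (measurableSet_lt measurable_const (hF i))

/-- **Integral of the `M`-th majorant.** Under the joint tail hypothesis (with measurable `F_i`),
`∫ ∏_i (1 + X_i^M) dμ ≤ exp (n q)` uniformly in `M`. -/
theorem lintegral_prodMaj_le {μ : Measure α} {n : ℕ} {F : Fin n → α → ℝ} (hF : ∀ i, Measurable (F i))
    {V p r γ : ℝ} (hp : 0 ≤ p) (hγr : γ < r)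
    (htail : ∀ (S : Finset (Fin n)) (m : Fin n → ℕ),
      μ {z | ∀ i ∈ S, V + (m i : ℝ) < F i z} ≤
        ENNReal.ofReal (∏ i ∈ S, p * Real.exp (-(r * (V + (m i : ℝ))))))
    (M : ℕ) :
    ∫⁻ z, prodMaj γ V F M z ∂μ ≤
      ENNReal.ofReal (Real.exp ((n : ℝ) *
        (p * Real.exp γ * Real.exp (-((r - γ) * V)) / (1 - Real.exp (-(r - γ)))))) := by
  classical
  set q : ℝ := p * Real.exp γ * Real.exp (-((r - γ) * V)) / (1 - Real.exp (-(r - γ))) with hq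
  -- Step 1: the expansion of the product of sums.
  have hexp : ∀ z, prodMaj γ V F M z =
      ∑ x : Fin n → Option (Fin (M + 1)), ∏ i, term γ V (F i) (x i) z := by
    intro z
    have h1 : prodMaj γ V F M z = ∏ i, ∑ j : Option (Fin (M + 1)), term γ V (F i) j z := by
      unfold prodMaj
      refine Finset.prod_congr rfl fun i _ => ?_
      rw [Fintype.sum_option, layer, Finset.sum_range]
      rfl
    rw [h1]
    exact Fintype.prod_sum fun i j => term γ V (F i) j z
  -- Step 2: measurability of each expansion term.
  have hmeas : ∀ x : Fin n → Option (Fin (M + 1)), Measurable fun z => ∏ i, term γ V (F i) (x i) z := by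
    intro x
    refine Finset.measurable_prod _ fun i _ => ?_
    rcases x i with _ | k
    · exact measurable_const
    · exact measurable_const.indicator (measurableSet_lt measurable_const (hF i))
  -- Step 3: the integral of each expansion term.
  have hterm : ∀ x : Fin n → Option (Fin (M + 1)),
      ∫⁻ z, ∏ i, term γ V (F i) (x i) z ∂μ ≤ ENNReal.ofReal (∏ i, br γ V p r (x i)) := by
    intro x
    set S : Finset (Fin n) := Finset.univ.filter fun i => x i ≠ none with hS
    set m : Fin n → ℕ := fun i => lev (x i) with hm
    set A : Set α := {z | ∀ i ∈ S, V + (m i : ℝ) < F i z} with hA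
    have hAmeas : MeasurableSet A :=
      measurableSet_setOf.2 (Measurable.forall fun i => Measurable.imp measurable_const
        (measurableSet_setOf.1 (measurableSet_lt measurable_const (hF i))))
    have hpt : ∀ z, ∏ i, term γ V (F i) (x i) z =
        A.indicator (fun _ => ENNReal.ofReal (∏ i, wr γ V (x i))) z := by
      intro z
      by_cases hz : z ∈ A
      · rw [Set.indicator_of_mem hz, ENNReal.ofReal_prod_of_nonneg fun i _ => wr_nonneg γ V (x i)]
        refine Finset.prod_congr rfl fun i _ => ?_
        rcases hx : x i with _ | k
        · simp [term, wr]
        · have hi : i ∈ S := by simp [hS, hx]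
          have hk : V + ((k : ℕ) : ℝ) < F i z := by simpa [hm, lev, hx] using hz i hi
          simp [term, wr, ev, hk]
      · rw [Set.indicator_of_notMem hz]
        simp only [hA, Set.mem_setOf_eq, not_forall] at hz
        obtain ⟨i, hi, hlt⟩ := hz
        apply Finset.prod_eq_zero (Finset.mem_univ i)
        have hxi : x i ≠ none := by simpa [hS] using hi
        obtain ⟨k, hk⟩ := Option.ne_none_iff_exists'.1 hxi
        have hk' : ¬ (V + ((k : ℕ) : ℝ) < F i z) := by simpa [hm, lev, hk] using hlt
        simp [term, hk, ev, hk']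
    have hint : ∫⁻ z, ∏ i, term γ V (F i) (x i) z ∂μ = ENNReal.ofReal (∏ i, wr γ V (x i)) * μ A := by
      rw [show (fun z => ∏ i, term γ V (F i) (x i) z) =
          A.indicator (fun _ => ENNReal.ofReal (∏ i, wr γ V (x i))) from funext hpt]
      exact lintegral_indicator_const hAmeas _
    rw [hint]
    calc ENNReal.ofReal (∏ i, wr γ V (x i)) * μ A
        ≤ ENNReal.ofReal (∏ i, wr γ V (x i)) *
            ENNReal.ofReal (∏ i ∈ S, p * Real.exp (-(r * (V + (m i : ℝ))))) :=
          mul_le_mul_right (htail S m) _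
      _ = ENNReal.ofReal (∏ i, br γ V p r (x i)) := by
          rw [← ENNReal.ofReal_mul (Finset.prod_nonneg fun i _ => wr_nonneg γ V (x i)), hS,
            Finset.prod_filter, ← Finset.prod_mul_distrib]
          congr 1
          refine Finset.prod_congr rfl fun i _ => ?_
          rcases hx : x i with _ | k
          · simp [wr, br]
          · simp [wr, br, bw, hm, lev, hx]
  -- Step 4: resummation.
  have hsum : (∑ x : Fin n → Option (Fin (M + 1)), ∏ i, br γ V p r (x i)) =
      (1 + ∑ k ∈ Finset.range (M + 1), bw γ V p r k) ^ n := by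
    calc (∑ x : Fin n → Option (Fin (M + 1)), ∏ i, br γ V p r (x i))
        = ∏ _i : Fin n, ∑ j : Option (Fin (M + 1)), br γ V p r j :=
          (Fintype.prod_sum fun (_ : Fin n) (j : Option (Fin (M + 1))) => br γ V p r j).symm
      _ = (1 + ∑ k ∈ Finset.range (M + 1), bw γ V p r k) ^ n := by
          rw [Finset.prod_const, Finset.card_univ, Fintype.card_fin, Fintype.sum_option, Finset.sum_range]
          rfl
  have hs0 : 0 ≤ ∑ k ∈ Finset.range (M + 1), bw γ V p r k :=
    Finset.sum_nonneg fun k _ => bw_nonneg γ V hp r k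
  have hreal : (1 + ∑ k ∈ Finset.range (M + 1), bw γ V p r k) ^ n ≤ Real.exp (n * q) := by
    have hsq : ∑ k ∈ Finset.range (M + 1), bw γ V p r k ≤ q := sum_bw_le hp hγr M
    calc (1 + ∑ k ∈ Finset.range (M + 1), bw γ V p r k) ^ n
        ≤ (1 + q) ^ n := pow_le_pow_left₀ (by linarith) (by linarith) n
      _ ≤ (Real.exp q) ^ n := pow_le_pow_left₀ (by linarith) (by linarith [Real.add_one_le_exp q]) n
      _ = Real.exp (n * q) := (Real.exp_nat_mul q n).symm
  -- Assembly.
  calc ∫⁻ z, prodMaj γ V F M z ∂μ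
      = ∫⁻ z, ∑ x : Fin n → Option (Fin (M + 1)), ∏ i, term γ V (F i) (x i) z ∂μ :=
        lintegral_congr fun z => hexp z
    _ = ∑ x : Fin n → Option (Fin (M + 1)), ∫⁻ z, ∏ i, term γ V (F i) (x i) z ∂μ :=
        lintegral_finsetSum _ fun x _ => hmeas x
    _ ≤ ∑ x : Fin n → Option (Fin (M + 1)), ENNReal.ofReal (∏ i, br γ V p r (x i)) :=
        Finset.sum_le_sum fun x _ => hterm x
    _ = ENNReal.ofReal (∑ x : Fin n → Option (Fin (M + 1)), ∏ i, br γ V p r (x i)) :=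
        (ENNReal.ofReal_sum_of_nonneg fun x _ =>
          Finset.prod_nonneg fun i _ => br_nonneg γ V hp r (x i)).symm
    _ ≤ ENNReal.ofReal (Real.exp (n * q)) := ENNReal.ofReal_le_ofReal (hsum ▸ hreal)

/-! ## The lemma -/

/-- **Measurable case.** For measurable `F_i` with the joint exponential tail bound,
`∫ exp (γ Σ_i tailFn V (F_i)) dμ ≤ exp (n q)`. -/
theorem lintegral_exp_sum_tailFn_le {μ : Measure α} {n : ℕ} {F : Fin n → α → ℝ}
    (hF : ∀ i, Measurable (F i)) {V p r γ : ℝ} (hp : 0 ≤ p) (hγ : 0 < γ) (hγr : γ < r)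
    (htail : ∀ (S : Finset (Fin n)) (m : Fin n → ℕ),
      μ {z | ∀ i ∈ S, V + (m i : ℝ) < F i z} ≤
        ENNReal.ofReal (∏ i ∈ S, p * Real.exp (-(r * (V + (m i : ℝ))))))  :
    ∫⁻ z, ENNReal.ofReal (Real.exp (γ * ∑ i, tailFn V (F i z))) ∂μ ≤
      ENNReal.ofReal (Real.exp ((n : ℝ) *
        (p * Real.exp γ * Real.exp (-((r - γ) * V)) / (1 - Real.exp (-(r - γ)))))) := by
  calc ∫⁻ z, ENNReal.ofReal (Real.exp (γ * ∑ i, tailFn V (F i z))) ∂μ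
      ≤ ∫⁻ z, ⨆ M, prodMaj γ V F M z ∂μ :=
        lintegral_mono fun z => ofReal_exp_sum_tailFn_le_iSup_prodMaj hγ.le F z
    _ = ⨆ M, ∫⁻ z, prodMaj γ V F M z ∂μ :=
        lintegral_iSup (fun M => measurable_prodMaj γ V hF M) (prodMaj_mono γ V F)
    _ ≤ _ := iSup_le fun M => lintegral_prodMaj_le hF hp hγr htail M

/-- **STUB 2g** `stub_lmgfOfJointTails : LMGFOfJointTails` — the generic exponential-moment-from-joint-tails lemma,
for a.e.-measurable functionals (reduction to measurable modifications, then `lintegral_exp_sum_tailFn_le`). -/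
theorem stub_lmgfOfJointTails : LMGFOfJointTails := by
  intro α _ μ _ n F hF V p r γ hp hγ hγr htail
  have hFG : ∀ᵐ z ∂μ, ∀ i, F i z = (hF i).mk (F i) z := ae_all_iff.2 fun i => (hF i).ae_eq_mk
  have h1 : ∫⁻ z, ENNReal.ofReal (Real.exp (γ * ∑ i, tailFn V (F i z))) ∂μ =
      ∫⁻ z, ENNReal.ofReal (Real.exp (γ * ∑ i, tailFn V ((hF i).mk (F i) z))) ∂μ :=
    lintegral_congr_ae (hFG.mono fun z hz => by simp only [hz])
  rw [h1]
  refine lintegral_exp_sum_tailFn_le (fun i => (hF i).measurable_mk) hp hγ hγr fun S m => ?_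
  calc μ {z | ∀ i ∈ S, V + (m i : ℝ) < (hF i).mk (F i) z}
      = μ {z | ∀ i ∈ S, V + (m i : ℝ) < F i z} := by
        refine measure_congr (Filter.eventuallyEq_set.2 ?_)
        filter_upwards [hFG] with z hz
        simp [hz]
    _ ≤ _ := htail S m

end Summit.AtomisticToContinuum.HydrodynamicLimit.Theorems.CollisionActivityTailsLMGFOfJointTails

end
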